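import Literature.Topology.FourManifolds.SubmersionStraightening
import Literature.Topology.FourManifolds.MorseChartChangeInterior
import Literature.Topology.FourManifolds.FlowFibreMorseAlgebra
import Mathlib.Analysis.Calculus.FDeriv.Symmetric
import HarnessLib

/-!
# Morse data of a function of separate variables `α(g₁) + β(g₂)`

Topic `Literature/Topology/FourManifolds` (Morse theory in product charts; fact seat
`provefact-Literature.Geometry.Symplectic.Oba2016_s-add47373d4`: the critical points of
`A ∘ f + m ∘ pr_F` on the product neighbourhood of a regular fibre of a Lefschetz fibration,
where `f` is the fibration and `pr_F` the fibre projection of an Ehresmann trivialisation).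
Everything is proved; no definitions, no named facts.

Let `M` be a `C^∞` manifold over a model with corners `I` on `ℝᴺ`, `a + b = N`, `x` an
interior point, `g₁ : M → ℝᵃ`, `g₂ : M → ℝᵇ` smooth at `x` whose combined differential
`v ↦ (dg₁ v, dg₂ v)` is bijective, and `F : M → ℝ` with `F = α ∘ g₁ + β ∘ g₂` near `x` for `C²`
functions `α`, `β` having critical points at `g₁ x`, `g₂ x`.  Then (Milnor, *Morse theory*
(1963), §2: critical points, Hessian and index are computed in any local coordinates; here in
the **product chart** `q ↦ (g₁ q, g₂ q)` of the maximal atlas, `exists_productChart`, in which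
`F` reads `α(w₁) + β(w₂)` and the Hessian is the orthogonal sum `Hess α ⊕ Hess β`):

* `isMCriticalPt_of_separateVariables` — `x` is a critical point of `F`;
* `nondegenerate_and_morseIndex_of_separateVariables` — if `Hess α (g₁ x)` and `Hess β (g₂ x)`
  are nondegenerate then so is `Hess F (x)`, and
  `index_x F = index_{g₁ x} α + index_{g₂ x} β` (`sigNeg_prod`, additivity of the index of
  inertia under orthogonal sum, `LatticeFormsOrthoSumSignature.lean`).

The Morse data of `α`, `β` are those of `Morse.lean` for the vector spaces `ℝᵃ`, `ℝᵇ` as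
manifolds over `𝓘(ℝ, ·)` (`mhessian_model_apply`: the Hessian is the plain second derivative).

## References

* J. Milnor, *Morse theory*, Ann. of Math. Studies 51 (1963), §2 (pp. 4–6). [Milnor1963]
* A. Kas, *On the handlebody decomposition associated to a Lefschetz fibration*, Pacific J.
  Math. 89 (1980), proof of Lemma 1.6. [Kas1980]
-/

open scoped Manifold ContDiff Topology
open Set Function Filter

noncomputable section

namespace Literature.Topology.FourManifolds

universe u

/-! ### §1 Morse data on a vector space -/

section Model

variable {E : Type*} [NormedAddCommGroup E] [NormedSpace ℝ E]

/-- On a normed space (model `𝓘(ℝ, E)`), a function written in the extended chart is the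
function itself. [folklore] -/
theorem writtenInExtChartAt_model (φ : E → ℝ) (u : E) :
    writtenInExtChartAt 𝓘(ℝ, E) 𝓘(ℝ, ℝ) u φ = φ := by
  ext z
  simp [writtenInExtChartAt]

/-- On a normed space, the chartwise Hessian of `Morse.lean` is the plain second Fréchet
derivative. [cite: Milnor1963, §2] -/
theorem mhessian_model_apply (φ : E → ℝ) (u v w : E) :
    mhessian 𝓘(ℝ, E) φ u v w = fderiv ℝ (fderiv ℝ φ) u v w := by
  rw [mhessian_apply_eq_fderiv_fderiv_of_isInteriorPoint' (I := 𝓘(ℝ, E))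
    BoundarylessManifold.isInteriorPoint, writtenInExtChartAt_model]
  rfl

/-- On a normed space, `u` is a critical point of `φ` (in the sense of `Morse.lean`) iff
`Dφ(u) = 0`, for `φ` differentiable at `u`. [cite: Milnor1963, §2] -/
theorem isMCriticalPt_model_iff {φ : E → ℝ} {u : E} (hφ : DifferentiableAt ℝ φ u) :
    IsMCriticalPt 𝓘(ℝ, E) φ u ↔ fderiv ℝ φ u = 0 := by
  unfold IsMCriticalPt
  rw [hφ.mdifferentiableAt.mfderiv, writtenInExtChartAt_model]
  simp only [modelWithCornersSelf_coe, range_id, fderivWithin_univ, extChartAt_self_apply]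
  exact Iff.rfl

end Model

/-! ### §2 The product chart -/

section ProductChart

variable {a b N : ℕ} {H : Type*} [TopologicalSpace H]
  {I : ModelWithCorners ℝ (EuclideanSpace ℝ (Fin N)) H}
  {M : Type u} [TopologicalSpace M] [ChartedSpace H M] [IsManifold I ∞ M]

/-- **The product chart.**  Let `g₁ : M → ℝᵃ`, `g₂ : M → ℝᵇ` be smooth on an open set
`s ∋ x`, `x` interior, `a + b = N`, with bijective combined differential
`v ↦ (dg₁ v, dg₂ v)` at `x`.  Then some chart `e` of the maximal `C^∞` atlas about `x`, with
source inside `s`, reads `e.extend I q = extChartAt I x x + appendCLE hab (g₁ q - g₁ x, g₂ q - g₂ x)`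
on its source (inverse function theorem for
`Θ y = y₀ + appendCLE (g₁ φ⁻¹ y - g₁ x, g₂ φ⁻¹ y - g₂ x)` in the chart `φ` at `x`, conjugated
into the model by `OpenPartialHomeomorph.conjModel`; Milnor 1963, §2: local coordinates;
Hirsch 1976, Ch. 1 §3). [cite: Milnor1963, §2] -/
theorem exists_productChart (hab : a + b = N) {g₁ : M → EuclideanSpace ℝ (Fin a)}
    {g₂ : M → EuclideanSpace ℝ (Fin b)} {x : M} {s : Set M} (hs : IsOpen s) (hxs : x ∈ s)
    (hx : I.IsInteriorPoint x)
    (hg₁ : ContMDiffOn I 𝓘(ℝ, EuclideanSpace ℝ (Fin a)) ∞ g₁ s)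
    (hg₂ : ContMDiffOn I 𝓘(ℝ, EuclideanSpace ℝ (Fin b)) ∞ g₂ s)
    (hbij : Bijective fun v : TangentSpace I x =>
      ((mfderiv I 𝓘(ℝ, EuclideanSpace ℝ (Fin a)) g₁ x v : EuclideanSpace ℝ (Fin a)),
        (mfderiv I 𝓘(ℝ, EuclideanSpace ℝ (Fin b)) g₂ x v : EuclideanSpace ℝ (Fin b)))) :
    ∃ e : OpenPartialHomeomorph M H, e ∈ IsManifold.maximalAtlas I ∞ M ∧ x ∈ e.source ∧
      e.source ⊆ s ∧ e.extend I x = extChartAt I x x ∧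
      ∀ q ∈ e.source, e.extend I q =
        extChartAt I x x + appendCLE hab (g₁ q - g₁ x, g₂ q - g₂ x) := by
  -- the chart at `x`, and `g₁`, `g₂` read in it
  set φ := chartAt H x with hφ
  set y₀ : EuclideanSpace ℝ (Fin N) := extChartAt I x x with hy₀
  have hy₀' : y₀ = I (φ x) := rfl
  set k₁ : EuclideanSpace ℝ (Fin N) → EuclideanSpace ℝ (Fin a) := g₁ ∘ (extChartAt I x).symm
    with hk₁
  set k₂ : EuclideanSpace ℝ (Fin N) → EuclideanSpace ℝ (Fin b) := g₂ ∘ (extChartAt I x).symm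
    with hk₂
  -- the open set `O ∋ y₀`
  have hTs : IsOpen (φ.target ∩ φ.symm ⁻¹' s) := φ.isOpen_inter_preimage_symm hs
  set O : Set (EuclideanSpace ℝ (Fin N)) := I.symm ⁻¹' (φ.target ∩ φ.symm ⁻¹' s) ∩ interior (range I)
    with hO
  have hOopen : IsOpen O := (hTs.preimage I.continuous_symm).inter isOpen_interior
  have hy₀O : y₀ ∈ O := by
    refine ⟨?_, hx⟩
    rw [mem_preimage, hy₀', I.left_inv]
    exact ⟨mem_chart_target H x, by rw [mem_preimage, φ.left_inv (mem_chart_source H x)]; exact hxs⟩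
  have hOsub : O ⊆ (extChartAt I x).target ∩ (extChartAt I x).symm ⁻¹' s := by
    rintro y ⟨⟨hy1, hy2⟩, hy3⟩
    refine ⟨?_, hy2⟩
    rw [extChartAt_target]
    exact ⟨hy1, interior_subset hy3⟩
  have hkO : ∀ {c : ℕ} {g : M → EuclideanSpace ℝ (Fin c)},
      ContMDiffOn I 𝓘(ℝ, EuclideanSpace ℝ (Fin c)) ∞ g s →
      ContDiffOn ℝ ∞ (g ∘ (extChartAt I x).symm) O := by
    intro c g hg
    have h := (contMDiffOn_iff.1 hg).2 x (g x)
    refine (h.mono ?_).congr ?_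
    · intro y hy
      obtain ⟨hy1, hy2⟩ := hOsub hy
      refine ⟨hy1, ?_⟩
      simp only [mem_preimage, mem_inter_iff, extChartAt_source, chartAt_self_eq,
        OpenPartialHomeomorph.refl_source, mem_univ, and_true]
      exact hy2
    · intro y _
      simp only [comp_apply, extChartAt_self_apply, modelWithCornersSelf_coe, id_eq]
  have hk₁O : ContDiffOn ℝ ∞ k₁ O := hkO hg₁
  have hk₂O : ContDiffOn ℝ ∞ k₂ O := hkO hg₂
  -- derivatives at `y₀`
  have hnhds : range I ∈ 𝓝 y₀ := Filter.mem_of_superset (isOpen_interior.mem_nhds hx) interior_subset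
  have hsx : s ∈ 𝓝 x := hs.mem_nhds hxs
  have hmd₁ : MDifferentiableAt I 𝓘(ℝ, EuclideanSpace ℝ (Fin a)) g₁ x :=
    (hg₁.contMDiffAt hsx).mdifferentiableAt (by simp)
  have hmd₂ : MDifferentiableAt I 𝓘(ℝ, EuclideanSpace ℝ (Fin b)) g₂ x :=
    (hg₂.contMDiffAt hsx).mdifferentiableAt (by simp)
  have hw₁ : writtenInExtChartAt I 𝓘(ℝ, EuclideanSpace ℝ (Fin a)) x g₁ = k₁ := by
    ext y; simp [writtenInExtChartAt, hk₁]
  have hw₂ : writtenInExtChartAt I 𝓘(ℝ, EuclideanSpace ℝ (Fin b)) x g₂ = k₂ := by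
    ext y; simp [writtenInExtChartAt, hk₂]
  have hL₁ : mfderiv I 𝓘(ℝ, EuclideanSpace ℝ (Fin a)) g₁ x = fderiv ℝ k₁ y₀ := by
    rw [hmd₁.mfderiv, hw₁, fderivWithin_of_mem_nhds hnhds]
  have hL₂ : mfderiv I 𝓘(ℝ, EuclideanSpace ℝ (Fin b)) g₂ x = fderiv ℝ k₂ y₀ := by
    rw [hmd₂.mfderiv, hw₂, fderivWithin_of_mem_nhds hnhds]
  have hk₁d : HasFDerivAt k₁ (fderiv ℝ k₁ y₀) y₀ :=
    ((hk₁O.contDiffAt (hOopen.mem_nhds hy₀O)).differentiableAt (by simp)).hasFDerivAt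
  have hk₂d : HasFDerivAt k₂ (fderiv ℝ k₂ y₀) y₀ :=
    ((hk₂O.contDiffAt (hOopen.mem_nhds hy₀O)).differentiableAt (by simp)).hasFDerivAt
  have hk₁y₀ : k₁ y₀ = g₁ x := by rw [hk₁, comp_apply, hy₀, extChartAt_to_inv]
  have hk₂y₀ : k₂ y₀ = g₂ x := by rw [hk₂, comp_apply, hy₀, extChartAt_to_inv]
  -- the map `Θ` and its bijective derivative
  set Θ : EuclideanSpace ℝ (Fin N) → EuclideanSpace ℝ (Fin N) :=
    fun y => y₀ + appendCLE hab (k₁ y - g₁ x, k₂ y - g₂ x) with hΘ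
  have hΘy₀ : Θ y₀ = y₀ := by
    simp only [hΘ, hk₁y₀, hk₂y₀, sub_self]
    rw [show ((0 : EuclideanSpace ℝ (Fin a)), (0 : EuclideanSpace ℝ (Fin b))) =
      (0 : EuclideanSpace ℝ (Fin a) × EuclideanSpace ℝ (Fin b)) from rfl, map_zero, add_zero]
  have hΘO : ContDiffOn ℝ ∞ Θ O :=
    contDiffOn_const.add ((appendCLE hab).contDiff.comp_contDiffOn
      ((hk₁O.sub contDiffOn_const).prodMk (hk₂O.sub contDiffOn_const)))
  set L : EuclideanSpace ℝ (Fin N) →L[ℝ] EuclideanSpace ℝ (Fin N) :=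
    (appendCLE hab : _ →L[ℝ] _).comp ((fderiv ℝ k₁ y₀).prod (fderiv ℝ k₂ y₀)) with hL
  have hΘderiv : HasFDerivAt Θ L y₀ := by
    have h := ((appendCLE hab).hasFDerivAt.comp y₀
      ((hk₁d.sub_const (g₁ x)).prodMk (hk₂d.sub_const (g₂ x)))).const_add y₀
    exact h
  have hLbij : Bijective L := by
    have h1 : Bijective fun v : EuclideanSpace ℝ (Fin N) => (fderiv ℝ k₁ y₀ v, fderiv ℝ k₂ y₀ v) := by
      have := hbij
      rw [hL₁, hL₂] at this
      exact this
    exact (appendCLE hab).bijective.comp h1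
  set T : EuclideanSpace ℝ (Fin N) ≃L[ℝ] EuclideanSpace ℝ (Fin N) :=
    (LinearEquiv.ofBijective (L : EuclideanSpace ℝ (Fin N) →ₗ[ℝ] EuclideanSpace ℝ (Fin N))
      hLbij).toContinuousLinearEquiv with hT
  have hΘderiv' : HasFDerivAt Θ (T : EuclideanSpace ℝ (Fin N) →L[ℝ] EuclideanSpace ℝ (Fin N)) y₀ :=
    hΘderiv.congr_fderiv (ContinuousLinearMap.ext fun v => rfl)
  -- the inverse function theorem
  obtain ⟨G, hGΘ, hy₀G, hGO, hGsm, hGsm'⟩ :=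
    exists_openPartialHomeomorph_contDiffOn_symm hOopen hy₀O (m := ∞) (by simp) hΘO T hΘderiv'
  -- the chart `e = (I⁻¹ G I) ∘ φ`
  set K := G.conjModel I with hK
  have hKmem : K ∈ contDiffGroupoid ∞ I :=
    OpenPartialHomeomorph.conjModel_mem_contDiffGroupoid hGsm hGsm'
  have hzK : φ x ∈ K.source := by
    rw [hK, OpenPartialHomeomorph.mem_conjModel_source, ← hy₀', hGΘ, hΘy₀]
    exact ⟨hx, hy₀G, hx⟩
  have hsource : ∀ q ∈ (φ ≫ₕ K).source, q ∈ s ∧ q ∈ (extChartAt I x).source := by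
    intro q hq
    rw [OpenPartialHomeomorph.trans_source] at hq
    obtain ⟨hq₁, hq₂⟩ := hq
    rw [mem_preimage, hK, OpenPartialHomeomorph.mem_conjModel_source] at hq₂
    have hq₃ : I (φ q) ∈ O := hGO hq₂.2.1
    refine ⟨?_, by rwa [extChartAt_source]⟩
    have := hq₃.1.2
    rw [mem_preimage, I.left_inv] at this
    have h' : φ.symm (φ q) ∈ s := this
    rwa [φ.left_inv hq₁] at h'
  refine ⟨φ ≫ₕ K, ?_, ?_, fun q hq => (hsource q hq).1, ?_, ?_⟩
  · exact (contDiffGroupoid ∞ I).trans_mem_maximalAtlas (IsManifold.chart_mem_maximalAtlas x)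
      hKmem
  · rw [OpenPartialHomeomorph.trans_source]
    exact ⟨mem_chart_source H x, hzK⟩
  · rw [OpenPartialHomeomorph.extend_coe, comp_apply, OpenPartialHomeomorph.coe_trans, comp_apply,
      OpenPartialHomeomorph.apply_conjModel_of_mem_source hzK, ← hy₀', hGΘ, hΘy₀]
  · intro q hq
    obtain ⟨-, hq'⟩ := hsource q hq
    rw [OpenPartialHomeomorph.trans_source] at hq
    rw [OpenPartialHomeomorph.extend_coe, comp_apply, OpenPartialHomeomorph.coe_trans, comp_apply,
      OpenPartialHomeomorph.apply_conjModel_of_mem_source hq.2, hGΘ]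
    simp only [hΘ, hk₁, hk₂, comp_apply]
    rw [show I (φ q) = extChartAt I x q from rfl, (extChartAt I x).left_inv hq']

end ProductChart

/-! ### §3 Morse data of `α(g₁) + β(g₂)` -/

section Calculus

variable {E E' : Type*} [NormedAddCommGroup E] [NormedSpace ℝ E] [NormedAddCommGroup E']
  [NormedSpace ℝ E']

/-- Second derivative of a sum of `C²` functions. [folklore] -/
theorem fderiv_fderiv_add_apply {f g : E → ℝ} {x : E} (hf : ContDiffAt ℝ 2 f x)
    (hg : ContDiffAt ℝ 2 g x) (v w : E) :
    fderiv ℝ (fderiv ℝ (fun y => f y + g y)) x v w =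
      fderiv ℝ (fderiv ℝ f) x v w + fderiv ℝ (fderiv ℝ g) x v w := by
  have hfd : ∀ᶠ y in 𝓝 x, DifferentiableAt ℝ f y :=
    (hf.eventually (by simp)).mono fun y hy => hy.differentiableAt (by simp)
  have hgd : ∀ᶠ y in 𝓝 x, DifferentiableAt ℝ g y :=
    (hg.eventually (by simp)).mono fun y hy => hy.differentiableAt (by simp)
  have heq : fderiv ℝ (fun y => f y + g y) =ᶠ[𝓝 x] fun y => fderiv ℝ f y + fderiv ℝ g y := by
    filter_upwards [hfd, hgd] with y hy1 hy2
    exact fderiv_add hy1 hy2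
  rw [heq.fderiv_eq]
  have h1 : DifferentiableAt ℝ (fderiv ℝ f) x :=
    (hf.fderiv_right (m := 1) (by norm_num)).differentiableAt (by simp)
  have h2 : DifferentiableAt ℝ (fderiv ℝ g) x :=
    (hg.fderiv_right (m := 1) (by norm_num)).differentiableAt (by simp)
  rw [show (fun y => fderiv ℝ f y + fderiv ℝ g y) = (fderiv ℝ f + fderiv ℝ g) from rfl,
    (h1.hasFDerivAt.add h2.hasFDerivAt).fderiv]
  rfl

/-- Second derivative of `α ∘ τ` at a point where `Dα` vanishes, for an affine `τ` with linear
part `P`: `D²(α ∘ τ)(u)(v, w) = D²α(τ u)(P v, P w)`. [cite: Milnor1963, §2] -/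
theorem fderiv_fderiv_comp_affine_apply {α : E' → ℝ} (P : E →L[ℝ] E') (c : E') {u : E}
    (hα : ContDiffAt ℝ 2 α (P u + c)) (hcrit : fderiv ℝ α (P u + c) = 0) (v w : E) :
    fderiv ℝ (fderiv ℝ (fun y => α (P y + c))) u v w =
      fderiv ℝ (fderiv ℝ α) (P u + c) (P v) (P w) := by
  have hτ : ContDiffAt ℝ 2 (fun y => P y + c) u := (P.contDiff.add contDiff_const).contDiffAt
  have h := fderiv_fderiv_comp_apply_of_fderiv_eq_zero (F := α) (τ := fun y => P y + c) hα hτ hcrit v w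
  have hP : fderiv ℝ (fun y => P y + c) u = P := by
    rw [fderiv_add_const]
    exact P.fderiv
  rw [hP] at h
  exact h

end Calculus

section SeparateVariables

variable {a b N : ℕ} {H : Type*} [TopologicalSpace H]
  {I : ModelWithCorners ℝ (EuclideanSpace ℝ (Fin N)) H}
  {M : Type u} [TopologicalSpace M] [ChartedSpace H M] [IsManifold I ∞ M]

/-- **Morse data of a function of separate variables** (Milnor 1963, §2, in the product chart
of `exists_productChart`).  With `g₁`, `g₂` as in `exists_productChart` and
`F = α ∘ g₁ + β ∘ g₂` near the interior point `x`, `α`, `β` of class `C²` with critical points at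
`g₁ x`, `g₂ x`: `x` is a critical point of `F`; and if the Hessians of `α` at `g₁ x` and of `β`
at `g₂ x` are nondegenerate, then the Hessian of `F` at `x` is nondegenerate with
`index_x F = index α + index β` (the Hessian read in the product chart is the orthogonal sum
`Hess α ⊕ Hess β`; `nondegenerate_prod_iff`, `sigNeg_prod`). [cite: Milnor1963, §2] -/
theorem morseData_of_separateVariables (hab : a + b = N) {g₁ : M → EuclideanSpace ℝ (Fin a)}
    {g₂ : M → EuclideanSpace ℝ (Fin b)} {x : M} {s : Set M} (hs : IsOpen s) (hxs : x ∈ s)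
    (hx : I.IsInteriorPoint x)
    (hg₁ : ContMDiffOn I 𝓘(ℝ, EuclideanSpace ℝ (Fin a)) ∞ g₁ s)
    (hg₂ : ContMDiffOn I 𝓘(ℝ, EuclideanSpace ℝ (Fin b)) ∞ g₂ s)
    (hbij : Bijective fun v : TangentSpace I x =>
      ((mfderiv I 𝓘(ℝ, EuclideanSpace ℝ (Fin a)) g₁ x v : EuclideanSpace ℝ (Fin a)),
        (mfderiv I 𝓘(ℝ, EuclideanSpace ℝ (Fin b)) g₂ x v : EuclideanSpace ℝ (Fin b))))
    {F : M → ℝ} {α : EuclideanSpace ℝ (Fin a) → ℝ} {β : EuclideanSpace ℝ (Fin b) → ℝ}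
    (hα : ContDiffAt ℝ 2 α (g₁ x)) (hβ : ContDiffAt ℝ 2 β (g₂ x))
    (hFev : F =ᶠ[𝓝 x] fun y => α (g₁ y) + β (g₂ y))
    (hα1 : IsMCriticalPt 𝓘(ℝ, EuclideanSpace ℝ (Fin a)) α (g₁ x))
    (hβ1 : IsMCriticalPt 𝓘(ℝ, EuclideanSpace ℝ (Fin b)) β (g₂ x)) :
    IsMCriticalPt I F x ∧
      ((mhessian 𝓘(ℝ, EuclideanSpace ℝ (Fin a)) α (g₁ x)).Nondegenerate →
        (mhessian 𝓘(ℝ, EuclideanSpace ℝ (Fin b)) β (g₂ x)).Nondegenerate →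
        (mhessian I F x).Nondegenerate ∧
          morseIndex I F x = morseIndex 𝓘(ℝ, EuclideanSpace ℝ (Fin a)) α (g₁ x) +
            morseIndex 𝓘(ℝ, EuclideanSpace ℝ (Fin b)) β (g₂ x)) := by
  obtain ⟨e, he, hxe, hes, hex, hext⟩ := exists_productChart hab hs hxs hx hg₁ hg₂ hbij
  have he2 : e ∈ IsManifold.maximalAtlas I 2 M :=
    IsManifold.maximalAtlas_subset_of_le (I := I) (M := M) (by norm_cast) he
  have he1 : e ∈ IsManifold.maximalAtlas I 1 M :=
    IsManifold.maximalAtlas_subset_of_le (I := I) (M := M) (by norm_cast) he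
  set y₀ : EuclideanSpace ℝ (Fin N) := extChartAt I x x with hy₀
  have hsx : s ∈ 𝓝 x := hs.mem_nhds hxs
  -- `F` is `C²` at `x`
  have hsum2 : ContMDiffAt I 𝓘(ℝ, ℝ) 2 (fun y => α (g₁ y) + β (g₂ y)) x :=
    (hα.comp_contMDiffAt ((hg₁.contMDiffAt hsx).of_le (by norm_cast))).add
      (hβ.comp_contMDiffAt ((hg₂.contMDiffAt hsx).of_le (by norm_cast)))
  have hF2 : ContMDiffAt I 𝓘(ℝ, ℝ) 2 F x := hsum2.congr_of_eventuallyEq hFev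
  -- the affine maps `τ₁`, `τ₂` and the chart function
  set P₁ : EuclideanSpace ℝ (Fin N) →L[ℝ] EuclideanSpace ℝ (Fin a) :=
    (ContinuousLinearMap.fst ℝ (EuclideanSpace ℝ (Fin a)) (EuclideanSpace ℝ (Fin b))).comp
      ((appendCLE hab).symm : EuclideanSpace ℝ (Fin N) →L[ℝ]
        EuclideanSpace ℝ (Fin a) × EuclideanSpace ℝ (Fin b)) with hP₁
  set P₂ : EuclideanSpace ℝ (Fin N) →L[ℝ] EuclideanSpace ℝ (Fin b) :=
    (ContinuousLinearMap.snd ℝ (EuclideanSpace ℝ (Fin a)) (EuclideanSpace ℝ (Fin b))).comp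
      ((appendCLE hab).symm : EuclideanSpace ℝ (Fin N) →L[ℝ]
        EuclideanSpace ℝ (Fin a) × EuclideanSpace ℝ (Fin b)) with hP₂
  set c₁ : EuclideanSpace ℝ (Fin a) := g₁ x - P₁ y₀ with hc₁
  set c₂ : EuclideanSpace ℝ (Fin b) := g₂ x - P₂ y₀ with hc₂
  have hτ₁y₀ : P₁ y₀ + c₁ = g₁ x := by rw [hc₁]; abel
  have hτ₂y₀ : P₂ y₀ + c₂ = g₂ x := by rw [hc₂]; abel
  -- the chart function equals `α(τ₁) + β(τ₂)` near `y₀`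
  have hchart : F ∘ (e.extend I).symm =ᶠ[𝓝 y₀]
      fun w => α (P₁ w + c₁) + β (P₂ w + c₂) := by
    have hint : y₀ ∈ interior (range I) := hx
    have htarget : (e.extend I).target ∈ 𝓝 y₀ := by
      rw [e.extend_target]
      refine Filter.inter_mem ?_ (Filter.mem_of_superset (isOpen_interior.mem_nhds hint) interior_subset)
      have h1 : e x ∈ e.target := e.map_source hxe
      have h2 : I.symm y₀ = e x := by
        rw [← hex, e.extend_coe, comp_apply, I.left_inv]
      exact (e.open_target.preimage I.continuous_symm).mem_nhds (by rw [mem_preimage, h2]; exact h1)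
    have hcont : ContinuousAt (e.extend I).symm y₀ := by
      rw [← hex]; exact e.continuousAt_extend_symm hxe
    have hsymm : (e.extend I).symm y₀ = x := by rw [← hex]; exact e.extend_left_inv (I := I) hxe
    have hev' : ∀ᶠ w in 𝓝 y₀, F ((e.extend I).symm w) =
        α (g₁ ((e.extend I).symm w)) + β (g₂ ((e.extend I).symm w)) := by
      have h : ∀ᶠ q in 𝓝 ((e.extend I).symm y₀), F q = α (g₁ q) + β (g₂ q) := by
        rw [hsymm]; exact hFev
      exact hcont.eventually h
    filter_upwards [htarget, hev'] with w hw hw'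
    have hq : (e.extend I).symm w ∈ e.source := by
      rw [← e.extend_source (I := I)]; exact (e.extend I).map_target hw
    have hqw : e.extend I ((e.extend I).symm w) = w := (e.extend I).right_inv hw
    have hform := hext _ hq
    rw [hqw] at hform
    -- read off `g₁`, `g₂` of the point from its chart value
    have hsplit : (appendCLE hab).symm (w - y₀) =
        (g₁ ((e.extend I).symm w) - g₁ x, g₂ ((e.extend I).symm w) - g₂ x) := by
      conv_lhs => rw [hform]
      rw [add_sub_cancel_left, ContinuousLinearEquiv.symm_apply_apply]
    have h1 : P₁ w + c₁ = g₁ ((e.extend I).symm w) := by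
      have e1 : P₁ w + c₁ = P₁ (w - y₀) + g₁ x := by rw [map_sub, hc₁]; abel
      rw [e1]
      change ((appendCLE hab).symm (w - y₀)).1 + g₁ x = _
      rw [hsplit, sub_add_cancel]
    have h2 : P₂ w + c₂ = g₂ ((e.extend I).symm w) := by
      have e2 : P₂ w + c₂ = P₂ (w - y₀) + g₂ x := by rw [map_sub, hc₂]; abel
      rw [e2]
      change ((appendCLE hab).symm (w - y₀)).2 + g₂ x = _
      rw [hsplit, sub_add_cancel]
    rw [comp_apply, hw', h1, h2]
  -- criticality of `α`, `β` in coordinates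
  have hα' : ContDiffAt ℝ 2 α (P₁ y₀ + c₁) := by rw [hτ₁y₀]; exact hα
  have hβ' : ContDiffAt ℝ 2 β (P₂ y₀ + c₂) := by rw [hτ₂y₀]; exact hβ
  have hαcrit : fderiv ℝ α (P₁ y₀ + c₁) = 0 := by
    rw [hτ₁y₀]; exact (isMCriticalPt_model_iff (hα.differentiableAt (by norm_num))).1 hα1
  have hβcrit : fderiv ℝ β (P₂ y₀ + c₂) = 0 := by
    rw [hτ₂y₀]; exact (isMCriticalPt_model_iff (hβ.differentiableAt (by norm_num))).1 hβ1
  have hA2 : ContDiffAt ℝ 2 (fun w => α (P₁ w + c₁)) y₀ :=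
    hα'.comp y₀ ((P₁.contDiff.add contDiff_const).contDiffAt)
  have hB2 : ContDiffAt ℝ 2 (fun w => β (P₂ w + c₂)) y₀ :=
    hβ'.comp y₀ ((P₂.contDiff.add contDiff_const).contDiffAt)
  -- ### `x` is critical
  have hcritF : IsMCriticalPt I F x := by
    rw [isMCriticalPt_iff_fderiv_comp_extend_symm_eq_zero_of_isInteriorPoint hF2 he2 hxe hx, hex,
      hchart.fderiv_eq]
    have hdA : HasFDerivAt (fun w => α (P₁ w + c₁)) ((fderiv ℝ α (P₁ y₀ + c₁)).comp P₁) y₀ :=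
      (hα'.differentiableAt (by norm_num)).hasFDerivAt.comp y₀ (P₁.hasFDerivAt.add_const c₁)
    have hdB : HasFDerivAt (fun w => β (P₂ w + c₂)) ((fderiv ℝ β (P₂ y₀ + c₂)).comp P₂) y₀ :=
      (hβ'.differentiableAt (by norm_num)).hasFDerivAt.comp y₀ (P₂.hasFDerivAt.add_const c₂)
    rw [show (fun w => α (P₁ w + c₁) + β (P₂ w + c₂)) =
        ((fun w => α (P₁ w + c₁)) + fun w => β (P₂ w + c₂)) from rfl,
      (hdA.add hdB).fderiv, hαcrit, hβcrit]
    simp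
  -- ### the Hessian in the product chart
  set Hα : LinearMap.BilinForm ℝ (EuclideanSpace ℝ (Fin a)) :=
    mhessian 𝓘(ℝ, EuclideanSpace ℝ (Fin a)) α (g₁ x) with hHα
  set Hβ : LinearMap.BilinForm ℝ (EuclideanSpace ℝ (Fin b)) :=
    mhessian 𝓘(ℝ, EuclideanSpace ℝ (Fin b)) β (g₂ x) with hHβ
  set A : EuclideanSpace ℝ (Fin N) ≃ₗ[ℝ] (EuclideanSpace ℝ (Fin a) × EuclideanSpace ℝ (Fin b)) :=
    (appendCLE hab).symm.toLinearEquiv with hAdef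
  have hrel : ∀ v w, hessianInChart I e F x v w = (Hα.prod Hβ) (A v) (A w) := by
    intro v w
    rw [hessianInChart_apply_eq_fderiv_fderiv_of_isInteriorPoint he1 hxe hx, hex,
      (hchart.fderiv).fderiv_eq, fderiv_fderiv_add_apply hA2 hB2,
      fderiv_fderiv_comp_affine_apply P₁ c₁ hα' hαcrit,
      fderiv_fderiv_comp_affine_apply P₂ c₂ hβ' hβcrit, hτ₁y₀, hτ₂y₀,
      LinearMap.BilinForm.prod_apply, hHα, hHβ, mhessian_model_apply, mhessian_model_apply]
    rfl
  -- ### conclusions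
  refine ⟨hcritF, fun hαn hβn => ?_⟩
  have hprod : (Hα.prod Hβ).Nondegenerate :=
    (LinearMap.BilinForm.nondegenerate_prod_iff Hα Hβ).2 ⟨hαn, hβn⟩
  refine ⟨?_, ?_⟩
  · rw [nondegenerate_mhessian_iff_of_isInteriorPoint hF2 hcritF he2 hxe hx,
      nondegenerate_iff_of_forall_apply_eq A hrel]
    exact hprod
  · have hsα : Hα.IsSymm := ⟨fun v w => by
      rw [hHα, mhessian_model_apply, mhessian_model_apply]
      exact hα.isSymmSndFDerivAt (by simp) v w⟩
    have hsβ : Hβ.IsSymm := ⟨fun v w => by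
      rw [hHβ, mhessian_model_apply, mhessian_model_apply]
      exact hβ.isSymmSndFDerivAt (by simp) v w⟩
    rw [morseIndex_eq_sigNeg_hessianInChart_of_isInteriorPoint hF2 hcritF he2 hxe hx,
      sigNeg_eq_of_forall_apply_eq A hrel, LinearMap.BilinForm.sigNeg_prod Hα Hβ hsα hsβ]
    rfl

end SeparateVariables


end Literature.Topology.FourManifolds

end
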